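import Summits.Ventures.QEC.Census.LRATLeavesBB
import Literature.InformationTheory.QuantumCodes.BBEvenDistance
import HarnessLib

/-!
# Kernel-B pinned certificates WITH PARITY for bivariate-bicycle codes (`wmax = d − 2`)

Cell `qec`, PARTITION row type-11 (K2 half of the certificate checker).  The translation-pinned kernel-B
assembly `BB.Code.le_hammingNorm_of_kernelB_pinned` / `d_eq_of_kernelB_pinned` (`Census/LRATLeavesBB.lean`)
consumes leaves of the CNF `Q_any(H^X, LX, wmax)` at `wmax = d − 1`.  For `QC(A, B)` with ODD `|A|`, `|B|`
(the printed weight-3 side condition `IsBBPoly`, [BravyiEtAl2024, §4]) every `Z`-logical has EVEN weight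
(`BB.Code.even_hammingNorm_of_HX_mulVec_eq_zero`, `Literature/…/BBEvenDistance.lean`), so for even `d`
the solver may stop at `wmax = d − 2`: «no pinned `Z`-logical of weight `≤ d − 2`» already gives
«every `Z`-logical has weight `≥ d`».  This is qec-search-2's scheme `sym` with `JOB_USE_PARITY=1`
(census/search-2/README «enc-v2 + parity (W = d − 2)», the `[[288,12,18]]` certificate shape) and the
intended kernel-B certificate of `[[144,12,12]]` (`W = 10`, side `Z` only since `d_X = d_Z`).

Results (all code-generic, `C : BB.Code ℓ m`, flat indices `Fin (ℓm + ℓm)` as in `LRATLeavesBB.lean`):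
* `BB.Code.le_hammingNorm_of_kernelB_pinned_of_odd` — pinned flat `Z`-logicals have weight `≥ d` from
  leaves at `d − 2`, `d` even;
* `BB.Code.d_eq_of_kernelB_pinned_of_odd` — with a flat weight-`d` witness: `C.d = d`
  (via type-12's `BB.Code.d_eq_of_pinned_witness_flat_of_odd`); `…_of_isBBPoly` wrapper;
* `BB.Code.le_hammingNorm_zLogical_of_kernelB_pinned_of_odd` — the ROUTE SHAPE
  (`BB144DistanceCertificate.NoZLogicalBelowTwelve` is this with `C = bb144`, `d = 12`): every
  `Z`-logical of `C.css` in `Mono ⊕ Mono` indexing has weight `≥ d`; `…_of_isBBPoly` wrapper.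
Leaf / cover / `hlog` hypotheses are literally those of `LRATLeavesBB.lean` with `d − 2` for `d − 1`.
-/

namespace Literature.InformationTheory.QuantumCodes.BB.Code

open Matrix Std.Sat Summit.Ventures.QEC.Census.CNFEncode Summit.Ventures.QEC.Census.LRATBridge

variable {ℓ m : ℕ} [NeZero ℓ] [NeZero m] (C : Code ℓ m)

/-- **Kernel-B pinned lower bound with parity**: for `QC(A, B)` with odd `|A|`, `|B|` and EVEN `d`, every
flat `Z`-logical `w` (`HXFlat w = 0`, `w ∉ rs HZFlat`) in one of the two translation cases (bit `0` set;
or left block clear and bit `ℓm` set) has weight `≥ d`, given the leaf UNSATs of `Q_any(H^X, LX, d − 2)`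
(case 0: `leafCNF n rows us (d-2) [] q`, `q ∈ cubes₀`; case 1: `… (pinZeros ℓm) q`, `q ∈ cubes₁`), the two
cube-coverage UNSATs, coordinate cube literals, and `hlog` (every flat `Z`-logical meets some `LX_j`
oddly).  Proof: `le_hammingNorm_of_kernelB_pinned` at `d − 1` gives `d − 1 ≤ ‖w‖`; `‖w‖` is even
(`even_hammingNorm_of_HX_mulVec_eq_zero` transported along `qubitIndex`; lift `le_of_even_of_sub_one_le`). -/
theorem le_hammingNorm_of_kernelB_pinned_of_odd (hA : Odd (hammingNorm C.A)) (hB : Odd (hammingNorm C.B))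
    {d k : ℕ} (hd : Even d) (LX : Fin k → Fin (ℓ * m + ℓ * m) → ZMod 2)
    (hlog : ∀ v : Fin (ℓ * m + ℓ * m) → ZMod 2, C.HXFlat *ᵥ v = 0 → v ∉ rowSpace C.HZFlat →
      ∃ j, LX j ⬝ᵥ v ≠ 0)
    (rows us : List (List ℕ)) (hrows : rowSupports C.HXFlat = rows) (hus : supports LX = us)
    (cubes₀ cubes₁ : List (List (Literal ℕ)))
    (hleaf₀ : ∀ q ∈ cubes₀, (leafCNF (ℓ * m + ℓ * m) rows us (d - 2) [] q).Unsat)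
    (hleaf₁ : ∀ q ∈ cubes₁, (leafCNF (ℓ * m + ℓ * m) rows us (d - 2) (pinZeros (ℓ * m)) q).Unsat)
    (hcover₀ : (coverCNF 0 cubes₀).Unsat) (hcover₁ : (coverCNF (ℓ * m) cubes₁).Unsat)
    (hlits₀ : ∀ q ∈ cubes₀, ∀ l ∈ q, l.1 < ℓ * m + ℓ * m)
    (hlits₁ : ∀ q ∈ cubes₁, ∀ l ∈ q, l.1 < ℓ * m + ℓ * m)
    (w : Fin (ℓ * m + ℓ * m) → ZMod 2) (hw : C.HXFlat *ᵥ w = 0) (hw' : w ∉ rowSpace C.HZFlat)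
    (hpin : w (qubitIndex (Sum.inl 0)) ≠ 0 ∨
      ((∀ i : Fin (ℓ * m + ℓ * m), (i : ℕ) < ℓ * m → w i = 0) ∧ w (qubitIndex (Sum.inr 0)) ≠ 0)) :
    d ≤ hammingNorm w := by
  have e : d - 1 - 1 = d - 2 := by omega
  have h1 : d - 1 ≤ hammingNorm w :=
    C.le_hammingNorm_of_kernelB_pinned (d := d - 1) LX hlog rows us hrows hus cubes₀ cubes₁
      (fun q hq => by rw [e]; exact hleaf₀ q hq) (fun q hq => by rw [e]; exact hleaf₁ q hq)
      hcover₀ hcover₁ hlits₀ hlits₁ w hw hw' hpin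
  have h2 := C.even_hammingNorm_of_HX_mulVec_eq_zero hA hB ((C.HXFlat_mulVec_eq_zero_iff w).1 hw)
  rw [BB.hammingNorm_comp_equiv w qubitIndex] at h2
  exact le_of_even_of_sub_one_le hd h2 h1

/-- **`C.d = d` from a translation-pinned kernel-B certificate with parity** (the `[[144,12,12]]` /
`[[288,12,18]]` kernel-B assembly shape): odd `|A|`, `|B|`; an explicit flat `Z`-logical `u` of weight `d`;
leaves of `Q_any(H^X, LX, d − 2)` in the two pinned cases, their coverage UNSATs, and `hlog` — via
type-12's `d_eq_of_pinned_witness_flat_of_odd` (parity excludes weight `d − 1`, the translation orbit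
reduces to pinned logicals). -/
theorem d_eq_of_kernelB_pinned_of_odd (hA : Odd (hammingNorm C.A)) (hB : Odd (hammingNorm C.B))
    {d k : ℕ} {u : Fin (ℓ * m + ℓ * m) → ZMod 2}
    (hu : C.HXFlat *ᵥ u = 0) (hu' : u ∉ rowSpace C.HZFlat) (hwt : hammingNorm u = d)
    (LX : Fin k → Fin (ℓ * m + ℓ * m) → ZMod 2)
    (hlog : ∀ v : Fin (ℓ * m + ℓ * m) → ZMod 2, C.HXFlat *ᵥ v = 0 → v ∉ rowSpace C.HZFlat →
      ∃ j, LX j ⬝ᵥ v ≠ 0)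
    (rows us : List (List ℕ)) (hrows : rowSupports C.HXFlat = rows) (hus : supports LX = us)
    (cubes₀ cubes₁ : List (List (Literal ℕ)))
    (hleaf₀ : ∀ q ∈ cubes₀, (leafCNF (ℓ * m + ℓ * m) rows us (d - 2) [] q).Unsat)
    (hleaf₁ : ∀ q ∈ cubes₁, (leafCNF (ℓ * m + ℓ * m) rows us (d - 2) (pinZeros (ℓ * m)) q).Unsat)
    (hcover₀ : (coverCNF 0 cubes₀).Unsat) (hcover₁ : (coverCNF (ℓ * m) cubes₁).Unsat)
    (hlits₀ : ∀ q ∈ cubes₀, ∀ l ∈ q, l.1 < ℓ * m + ℓ * m)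
    (hlits₁ : ∀ q ∈ cubes₁, ∀ l ∈ q, l.1 < ℓ * m + ℓ * m) : C.d = d := by
  have e : d - 1 - 1 = d - 2 := by omega
  exact C.d_eq_of_pinned_witness_flat_of_odd hA hB hu hu' hwt fun w hw hw' hpin =>
    C.le_hammingNorm_of_kernelB_pinned (d := d - 1) LX hlog rows us hrows hus cubes₀ cubes₁
      (fun q hq => by rw [e]; exact hleaf₀ q hq) (fun q hq => by rw [e]; exact hleaf₁ q hq)
      hcover₀ hcover₁ hlits₀ hlits₁ w hw hw' hpin

/-- `d_eq_of_kernelB_pinned_of_odd` under the printed weight-3 side condition `IsBBPoly A ∧ IsBBPoly B`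
(`odd_hammingNorm_of_isBBPoly`; e.g. `isBBPoly_bb144`). -/
theorem d_eq_of_kernelB_pinned_of_isBBPoly (hAB : IsBBPoly C.A ∧ IsBBPoly C.B)
    {d k : ℕ} {u : Fin (ℓ * m + ℓ * m) → ZMod 2}
    (hu : C.HXFlat *ᵥ u = 0) (hu' : u ∉ rowSpace C.HZFlat) (hwt : hammingNorm u = d)
    (LX : Fin k → Fin (ℓ * m + ℓ * m) → ZMod 2)
    (hlog : ∀ v : Fin (ℓ * m + ℓ * m) → ZMod 2, C.HXFlat *ᵥ v = 0 → v ∉ rowSpace C.HZFlat →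
      ∃ j, LX j ⬝ᵥ v ≠ 0)
    (rows us : List (List ℕ)) (hrows : rowSupports C.HXFlat = rows) (hus : supports LX = us)
    (cubes₀ cubes₁ : List (List (Literal ℕ)))
    (hleaf₀ : ∀ q ∈ cubes₀, (leafCNF (ℓ * m + ℓ * m) rows us (d - 2) [] q).Unsat)
    (hleaf₁ : ∀ q ∈ cubes₁, (leafCNF (ℓ * m + ℓ * m) rows us (d - 2) (pinZeros (ℓ * m)) q).Unsat)
    (hcover₀ : (coverCNF 0 cubes₀).Unsat) (hcover₁ : (coverCNF (ℓ * m) cubes₁).Unsat)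
    (hlits₀ : ∀ q ∈ cubes₀, ∀ l ∈ q, l.1 < ℓ * m + ℓ * m)
    (hlits₁ : ∀ q ∈ cubes₁, ∀ l ∈ q, l.1 < ℓ * m + ℓ * m) : C.d = d :=
  C.d_eq_of_kernelB_pinned_of_odd (odd_hammingNorm_of_isBBPoly hAB.1) (odd_hammingNorm_of_isBBPoly hAB.2)
    hu hu' hwt LX hlog rows us hrows hus cubes₀ cubes₁ hleaf₀ hleaf₁ hcover₀ hcover₁ hlits₀ hlits₁

/-- **Route shape with parity** (`BB144DistanceCertificate.NoZLogicalBelowTwelve` is this with `C = bb144`,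
`d = 12`): for odd `|A|`, `|B|` and even `d`, every `Z`-logical of `C.css` — `Mono ⊕ Mono` indexing — has
weight `≥ d`, from the pinned kernel-B certificate at `wmax = d − 2` (`le_hammingNorm_zLogical_of_kernelB_pinned`
at `d − 1`, then evenness of `‖v‖`). -/
theorem le_hammingNorm_zLogical_of_kernelB_pinned_of_odd (hA : Odd (hammingNorm C.A))
    (hB : Odd (hammingNorm C.B)) {d k : ℕ} (hd : Even d)
    (LX : Fin k → Fin (ℓ * m + ℓ * m) → ZMod 2)
    (hlog : ∀ v : Fin (ℓ * m + ℓ * m) → ZMod 2, C.HXFlat *ᵥ v = 0 → v ∉ rowSpace C.HZFlat →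
      ∃ j, LX j ⬝ᵥ v ≠ 0)
    (rows us : List (List ℕ)) (hrows : rowSupports C.HXFlat = rows) (hus : supports LX = us)
    (cubes₀ cubes₁ : List (List (Literal ℕ)))
    (hleaf₀ : ∀ q ∈ cubes₀, (leafCNF (ℓ * m + ℓ * m) rows us (d - 2) [] q).Unsat)
    (hleaf₁ : ∀ q ∈ cubes₁, (leafCNF (ℓ * m + ℓ * m) rows us (d - 2) (pinZeros (ℓ * m)) q).Unsat)
    (hcover₀ : (coverCNF 0 cubes₀).Unsat) (hcover₁ : (coverCNF (ℓ * m) cubes₁).Unsat)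
    (hlits₀ : ∀ q ∈ cubes₀, ∀ l ∈ q, l.1 < ℓ * m + ℓ * m)
    (hlits₁ : ∀ q ∈ cubes₁, ∀ l ∈ q, l.1 < ℓ * m + ℓ * m)
    (v : Mono ℓ m ⊕ Mono ℓ m → ZMod 2) (hv : C.css.HX *ᵥ v = 0) (hv' : v ∉ C.css.rowSpZ) :
    d ≤ hammingNorm v := by
  have e : d - 1 - 1 = d - 2 := by omega
  have h1 : d - 1 ≤ hammingNorm v :=
    C.le_hammingNorm_zLogical_of_kernelB_pinned (d := d - 1) LX hlog rows us hrows hus cubes₀ cubes₁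
      (fun q hq => by rw [e]; exact hleaf₀ q hq) (fun q hq => by rw [e]; exact hleaf₁ q hq)
      hcover₀ hcover₁ hlits₀ hlits₁ v hv hv'
  exact le_of_even_of_sub_one_le hd (C.even_hammingNorm_of_HX_mulVec_eq_zero hA hB hv) h1

/-- The route shape under `IsBBPoly A ∧ IsBBPoly B` (e.g. `isBBPoly_bb144`; `Even 12` by `decide`). -/
theorem le_hammingNorm_zLogical_of_kernelB_pinned_of_isBBPoly (hAB : IsBBPoly C.A ∧ IsBBPoly C.B)
    {d k : ℕ} (hd : Even d) (LX : Fin k → Fin (ℓ * m + ℓ * m) → ZMod 2)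
    (hlog : ∀ v : Fin (ℓ * m + ℓ * m) → ZMod 2, C.HXFlat *ᵥ v = 0 → v ∉ rowSpace C.HZFlat →
      ∃ j, LX j ⬝ᵥ v ≠ 0)
    (rows us : List (List ℕ)) (hrows : rowSupports C.HXFlat = rows) (hus : supports LX = us)
    (cubes₀ cubes₁ : List (List (Literal ℕ)))
    (hleaf₀ : ∀ q ∈ cubes₀, (leafCNF (ℓ * m + ℓ * m) rows us (d - 2) [] q).Unsat)
    (hleaf₁ : ∀ q ∈ cubes₁, (leafCNF (ℓ * m + ℓ * m) rows us (d - 2) (pinZeros (ℓ * m)) q).Unsat)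
    (hcover₀ : (coverCNF 0 cubes₀).Unsat) (hcover₁ : (coverCNF (ℓ * m) cubes₁).Unsat)
    (hlits₀ : ∀ q ∈ cubes₀, ∀ l ∈ q, l.1 < ℓ * m + ℓ * m)
    (hlits₁ : ∀ q ∈ cubes₁, ∀ l ∈ q, l.1 < ℓ * m + ℓ * m)
    (v : Mono ℓ m ⊕ Mono ℓ m → ZMod 2) (hv : C.css.HX *ᵥ v = 0) (hv' : v ∉ C.css.rowSpZ) :
    d ≤ hammingNorm v :=
  C.le_hammingNorm_zLogical_of_kernelB_pinned_of_odd (odd_hammingNorm_of_isBBPoly hAB.1)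
    (odd_hammingNorm_of_isBBPoly hAB.2) hd LX hlog rows us hrows hus cubes₀ cubes₁ hleaf₀ hleaf₁ hcover₀
    hcover₁ hlits₀ hlits₁ v hv hv'

end Literature.InformationTheory.QuantumCodes.BB.Code
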